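import Literature.NumberTheory.GaloisRepresentations.ContinuousRep
import Mathlib.RepresentationTheory.Irreducible
import Mathlib.Data.Matrix.Block
import Mathlib.LinearAlgebra.Matrix.ToLin
import Mathlib.LinearAlgebra.Matrix.NonsingularInverse
import HarnessLib

/-!
# The residual class realised by a `ℤ̄_p`-lattice is unique (projectively) — A. Schur and the residual algebra

Lead prover-line-stmt-Langlands-13639-c2-0 (line `sector-klingen-split`, crux `ResiduallyYoshidaLifting`,
stmt-Langlands-13639), skeleton rev 2.  Companion to Ribet's EXISTENCE theorem `stub_ribetNonsplitLattice`:
**uniqueness**.  If two `ℤ̄_p`-integral frames of the same `r : Γ → GL₄(ℚ̄_p)` reduce (up to residual conjugators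
`h₁, h₂ ∈ GL₄(k)`) to `(σ, B₁; 0, σ')` and `(σ, B₂; 0, σ')` with `B₁`, `B₂` NOT coboundaries, `σ, σ'` irreducible
and non-conjugate, then `B₂ = c • B₁ + (σ X - X σ')` for some `c ∈ kˣ` and `X`: an irreducible (indeed any) `r`
realises AT MOST ONE point of `ℙ H¹(Γ, Hom(σ', σ))` in each orientation.  Together with existence, every
irreducible `Sh`-point `ρ` carries a well-defined invariant `[B_ρ] ∈ ℙ H¹`; the anchor / propagation stubs of the
line are statements about the fibres of `ρ ↦ [B_ρ]`.

This file (A): matrix forms of Schur's lemma (Mathlib `Representation.IsIrreducible.bijective_or_eq_zero`,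
`algebraMap_intertwiningMap_bijective_of_isAlgClosed`) and the RESIDUAL algebra `class_unique_of_intertwiner`
(registered as `stub_classUniqueResidual`): a non-zero intertwiner `N` between `(σ, B₁; 0, σ')` and `(σ, B₂; 0, σ')`
forces `B₂ = c • B₁ + (σ X - X σ')` — its lower-left block intertwines `σ → σ'` hence vanishes (non-conjugacy),
its diagonal blocks are scalars `a, d`, its upper-right block gives `a B₂ = d B₁ + (σ X - X σ')`, and `a, d ≠ 0`
because `B₁, B₂` are not coboundaries and `N ≠ 0`.  File B lifts this to `ℤ̄_p`-integral frames.
Refs: Ribet 1976 Prop. 2.1; Bellaïche–Chenevier 2009 §1.5.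
-/

noncomputable section

open scoped MatrixGroups

open Matrix IsLocalRing

-- `Summit.Langlands.Langlands.…` (summit = sub-problem name, D-0017 layout) trips `dupNamespace` on every decl.
set_option linter.dupNamespace false
set_option autoImplicit false

namespace Summit.Langlands.Langlands.Cruxes.ResiduallyYoshidaLifting.SectorKlingenSplit.Ribet

open Literature.NumberTheory.GaloisRepresentations

/-! ### Schur's lemma in matrix form -/

section Schur

variable {k : Type*} [Field k] {Γ : Type*} [Group Γ] {n : ℕ}

/-- The intertwining map attached to a matrix intertwiner `τ(g) T = T σ(g)`. [folklore] -/
theorem exists_intertwiningMap_of_matrix (σ τ : Γ →* GL (Fin n) k) (T : Matrix (Fin n) (Fin n) k)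
    (hT : ∀ g, ((τ g : GL (Fin n) k) : Matrix (Fin n) (Fin n) k) * T =
      T * ((σ g : GL (Fin n) k) : Matrix (Fin n) (Fin n) k)) :
    ∃ f : Representation.IntertwiningMap ((glStdRepresentation (Fin n) k).comp σ)
      ((glStdRepresentation (Fin n) k).comp τ), ∀ v, f v = T *ᵥ v := by
  refine ⟨(Matrix.toLin' T).intertwiningMap_of_isIntertwiningMap _ _ (fun g v => ?_), fun v => rfl⟩
  change T *ᵥ (((σ g : GL (Fin n) k) : Matrix (Fin n) (Fin n) k) *ᵥ v) =
    ((τ g : GL (Fin n) k) : Matrix (Fin n) (Fin n) k) *ᵥ (T *ᵥ v)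
  rw [Matrix.mulVec_mulVec, Matrix.mulVec_mulVec, hT g]

/-- **Schur, first form**: a matrix intertwiner between IRREDUCIBLE representations is zero or invertible.
[folklore] -/
theorem intertwiner_eq_zero_or_isUnit (σ τ : Γ →* GL (Fin n) k)
    (hσ : Representation.IsIrreducible ((glStdRepresentation (Fin n) k).comp σ))
    (hτ : Representation.IsIrreducible ((glStdRepresentation (Fin n) k).comp τ))
    (T : Matrix (Fin n) (Fin n) k)
    (hT : ∀ g, ((τ g : GL (Fin n) k) : Matrix (Fin n) (Fin n) k) * T =
      T * ((σ g : GL (Fin n) k) : Matrix (Fin n) (Fin n) k)) :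
    T = 0 ∨ IsUnit T := by
  haveI := hσ
  haveI := hτ
  obtain ⟨f, hf⟩ := exists_intertwiningMap_of_matrix σ τ T hT
  rcases Representation.IsIrreducible.bijective_or_eq_zero f with hb | h0
  · right
    have hinj : Function.Injective T.mulVec := by
      intro v w hvw
      exact hb.1 (by rw [hf v, hf w]; exact hvw)
    exact (Matrix.mulVec_injective_iff_isUnit).mp hinj
  · left
    have hv : ∀ v, T *ᵥ v = 0 := fun v => by
      rw [← hf v, h0]
      rfl
    have : Matrix.toLin' T = 0 := LinearMap.ext fun v => by rw [Matrix.toLin'_apply, hv]; rfl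
    exact Matrix.toLin'.map_eq_zero_iff.mp this

/-- **Schur, non-conjugate form**: a matrix intertwiner `τ(g) T = T σ(g)` between irreducible, NON-conjugate
representations vanishes. [folklore] -/
theorem intertwiner_eq_zero_of_not_conj (σ τ : Γ →* GL (Fin n) k)
    (hσ : Representation.IsIrreducible ((glStdRepresentation (Fin n) k).comp σ))
    (hτ : Representation.IsIrreducible ((glStdRepresentation (Fin n) k).comp τ))
    (hnc : ¬ ∃ u : GL (Fin n) k, ∀ x, u * σ x * u⁻¹ = τ x)
    (T : Matrix (Fin n) (Fin n) k)
    (hT : ∀ g, ((τ g : GL (Fin n) k) : Matrix (Fin n) (Fin n) k) * T =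
      T * ((σ g : GL (Fin n) k) : Matrix (Fin n) (Fin n) k)) :
    T = 0 := by
  rcases intertwiner_eq_zero_or_isUnit σ τ hσ hτ T hT with h0 | hu
  · exact h0
  · exfalso
    obtain ⟨u, rfl⟩ := hu
    refine hnc ⟨u, fun x => ?_⟩
    rw [mul_inv_eq_iff_eq_mul]
    exact Units.ext (hT x).symm

/-- **Schur, scalar form**: over an algebraically closed field a matrix commuting with an irreducible
representation is a scalar. [folklore] -/
theorem intertwiner_eq_smul_one [IsAlgClosed k] (σ : Γ →* GL (Fin n) k)
    (hσ : Representation.IsIrreducible ((glStdRepresentation (Fin n) k).comp σ))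
    (T : Matrix (Fin n) (Fin n) k)
    (hT : ∀ g, ((σ g : GL (Fin n) k) : Matrix (Fin n) (Fin n) k) * T =
      T * ((σ g : GL (Fin n) k) : Matrix (Fin n) (Fin n) k)) :
    ∃ a : k, T = a • (1 : Matrix (Fin n) (Fin n) k) := by
  haveI := hσ
  obtain ⟨f, hf⟩ := exists_intertwiningMap_of_matrix σ σ T hT
  obtain ⟨a, ha⟩ :=
    (Representation.IsIrreducible.algebraMap_intertwiningMap_bijective_of_isAlgClosed
      (ρ := (glStdRepresentation (Fin n) k).comp σ)).2 f
  refine ⟨a, ?_⟩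
  have hv : ∀ v, T *ᵥ v = a • v := fun v => by
    have h1 : (a • (1 : Representation.IntertwiningMap ((glStdRepresentation (Fin n) k).comp σ)
        ((glStdRepresentation (Fin n) k).comp σ))) v = f v := by
      rw [← Representation.IntertwiningMap.algebraMap_apply, ha]
    rw [Representation.IntertwiningMap.smul_apply, Representation.IntertwiningMap.coe_one, id_eq, hf v] at h1
    exact h1.symm
  have : Matrix.toLin' T = Matrix.toLin' (a • (1 : Matrix (Fin n) (Fin n) k)) :=
    LinearMap.ext fun v => by
      rw [Matrix.toLin'_apply, Matrix.toLin'_apply, Matrix.smul_mulVec, Matrix.one_mulVec]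
      exact hv v
  exact Matrix.toLin'.injective this

end Schur

/-! ### The residual algebra: two non-split upper-triangular reductions with a non-zero intertwiner -/

section Residual

variable {k : Type*} [Field k] [IsAlgClosed k] {Γ : Type*} [Group Γ]

/-- **Projective uniqueness of the realised class, residual form.**  Let `σ, σ' : Γ → GL₂(k)` be irreducible
and non-conjugate, `B₁, B₂ : Γ → M₂(k)` not coboundaries, and `N ≠ 0` a `4 × 4` matrix with
`(σ, B₁; 0, σ') N = N (σ, B₂; 0, σ')` for all `g`.  Then `B₂ = c • B₁ + (σ X - X σ')` with `c ∈ kˣ`. [folklore] -/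
theorem class_unique_of_intertwiner (σ σ' : Γ →* GL (Fin 2) k)
    (hσ : Representation.IsIrreducible ((glStdRepresentation (Fin 2) k).comp σ))
    (hσ' : Representation.IsIrreducible ((glStdRepresentation (Fin 2) k).comp σ'))
    (hnc : ¬ ∃ u : GL (Fin 2) k, ∀ x, u * σ x * u⁻¹ = σ' x)
    (B₁ B₂ : Γ → Matrix (Fin 2) (Fin 2) k)
    (hB₁ : ¬ ∃ X : Matrix (Fin 2) (Fin 2) k, ∀ g, B₁ g = (σ g).val * X - X * (σ' g).val)
    (hB₂ : ¬ ∃ X : Matrix (Fin 2) (Fin 2) k, ∀ g, B₂ g = (σ g).val * X - X * (σ' g).val)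
    (N : Matrix (Fin 2 ⊕ Fin 2) (Fin 2 ⊕ Fin 2) k) (hN : N ≠ 0)
    (hint : ∀ g, Matrix.fromBlocks (σ g).val (B₁ g) 0 (σ' g).val * N =
      N * Matrix.fromBlocks (σ g).val (B₂ g) 0 (σ' g).val) :
    ∃ (c : kˣ) (X : Matrix (Fin 2) (Fin 2) k), ∀ g, B₂ g = (c : k) • B₁ g + ((σ g).val * X - X * (σ' g).val) := by
  -- block form of `N` and of the intertwining relation
  set N₁₁ := N.toBlocks₁₁
  set N₁₂ := N.toBlocks₁₂
  set N₂₁ := N.toBlocks₂₁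
  set N₂₂ := N.toBlocks₂₂
  have hNb : N = Matrix.fromBlocks N₁₁ N₁₂ N₂₁ N₂₂ := (Matrix.fromBlocks_toBlocks N).symm
  have hblk : ∀ g,
      (σ g).val * N₁₁ + B₁ g * N₂₁ = N₁₁ * (σ g).val ∧
      (σ g).val * N₁₂ + B₁ g * N₂₂ = N₁₁ * B₂ g + N₁₂ * (σ' g).val ∧
      (σ' g).val * N₂₁ = N₂₁ * (σ g).val ∧
      (σ' g).val * N₂₂ = N₂₁ * B₂ g + N₂₂ * (σ' g).val := by
    intro g
    have h := hint g
    rw [hNb, Matrix.fromBlocks_multiply, Matrix.fromBlocks_multiply] at h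
    obtain ⟨h11, h12, h21, h22⟩ := Matrix.fromBlocks_inj.mp h
    simp only [Matrix.zero_mul, zero_add, Matrix.mul_zero, add_zero] at h11 h12 h21 h22
    exact ⟨h11, h12, h21, h22⟩
  -- lower-left block: an intertwiner `σ → σ'`, hence zero
  have h21 : N₂₁ = 0 :=
    intertwiner_eq_zero_of_not_conj σ σ' hσ hσ' hnc N₂₁ fun g => (hblk g).2.2.1
  -- diagonal blocks: scalars
  obtain ⟨a, ha⟩ : ∃ a : k, N₁₁ = a • (1 : Matrix (Fin 2) (Fin 2) k) :=
    intertwiner_eq_smul_one σ hσ N₁₁ fun g => by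
      have h := (hblk g).1
      rw [h21, Matrix.mul_zero, add_zero] at h
      exact h
  obtain ⟨d, hd⟩ : ∃ d : k, N₂₂ = d • (1 : Matrix (Fin 2) (Fin 2) k) :=
    intertwiner_eq_smul_one σ' hσ' N₂₂ fun g => by
      have h := (hblk g).2.2.2
      rw [h21, Matrix.zero_mul, zero_add] at h
      exact h
  -- upper-right block: `a • B₂ = d • B₁ + (σ N₁₂ - N₁₂ σ')`
  have h12 : ∀ g, a • B₂ g = d • B₁ g + ((σ g).val * N₁₂ - N₁₂ * (σ' g).val) := by
    intro g
    have h := (hblk g).2.1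
    rw [ha, hd, Matrix.mul_smul, Matrix.mul_one, Matrix.smul_mul, Matrix.one_mul] at h
    rw [eq_sub_of_add_eq h.symm]
    abel
  -- `a ≠ 0`
  have ha0 : a ≠ 0 := by
    intro ha0
    rw [ha0] at h12
    -- then `d • B₁` is a coboundary, so `d = 0`
    have hd0 : d = 0 := by
      by_contra hd0
      refine hB₁ ⟨(-d⁻¹) • N₁₂, fun g => ?_⟩
      have h := h12 g
      rw [zero_smul] at h
      have h' : d • B₁ g = -((σ g).val * N₁₂ - N₁₂ * (σ' g).val) := eq_neg_of_add_eq_zero_left h.symm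
      calc B₁ g = d⁻¹ • (d • B₁ g) := by rw [smul_smul, inv_mul_cancel₀ hd0, one_smul]
        _ = (-d⁻¹) • ((σ g).val * N₁₂ - N₁₂ * (σ' g).val) := by rw [h', smul_neg, neg_smul]
        _ = (σ g).val * ((-d⁻¹) • N₁₂) - (-d⁻¹) • N₁₂ * (σ' g).val := by
          rw [Matrix.mul_smul, Matrix.smul_mul, smul_sub]
    -- then `N₁₂` intertwines `σ' → σ`, hence is zero, and `N = 0`
    rw [hd0] at h12
    have hN12 : N₁₂ = 0 := by
      have hnc' : ¬ ∃ u : GL (Fin 2) k, ∀ x, u * σ' x * u⁻¹ = σ x := by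
        rintro ⟨u, hu⟩
        exact hnc ⟨u⁻¹, fun x => by rw [← hu x]; group⟩
      refine intertwiner_eq_zero_of_not_conj σ' σ hσ' hσ hnc' N₁₂ fun g => ?_
      have h := h12 g
      rw [zero_smul, zero_smul, zero_add] at h
      exact (sub_eq_zero.mp h.symm)
    apply hN
    rw [hNb, ha, hd, h21, hN12, ha0, hd0]
    simp only [zero_smul, Matrix.fromBlocks_zero]
  -- `d ≠ 0`
  have hd0 : d ≠ 0 := by
    intro hd0
    rw [hd0] at h12
    refine hB₂ ⟨a⁻¹ • N₁₂, fun g => ?_⟩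
    have h := h12 g
    rw [zero_smul, zero_add] at h
    rw [Matrix.mul_smul, Matrix.smul_mul, ← smul_sub, ← h, smul_smul, inv_mul_cancel₀ ha0, one_smul]
  -- conclude with `c = d / a`, `X = a⁻¹ • N₁₂`
  refine ⟨Units.mk0 (a⁻¹ * d) (mul_ne_zero (inv_ne_zero ha0) hd0), a⁻¹ • N₁₂, fun g => ?_⟩
  rw [Units.val_mk0, Matrix.mul_smul, Matrix.smul_mul, ← smul_sub, mul_smul, ← smul_add, ← h12 g, smul_smul,
    inv_mul_cancel₀ ha0, one_smul]

end Residual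

/-- **Registered statement `stub_classUniqueResidual`** (crux stmt-Langlands-13639, line `sector-klingen-split`, skeleton
rev 2): the residual uniqueness `class_unique_of_intertwiner` with explicit binders. [folklore] -/
theorem stub_classUniqueResidual :
    ∀ (k : Type) [Field k] [IsAlgClosed k] (Γ : Type) [Group Γ] (σ σ' : Γ →* GL (Fin 2) k),
      Representation.IsIrreducible ((Literature.NumberTheory.GaloisRepresentations.glStdRepresentation (Fin 2) k).comp σ) →
      Representation.IsIrreducible ((Literature.NumberTheory.GaloisRepresentations.glStdRepresentation (Fin 2) k).comp σ') →
      (¬ ∃ u : GL (Fin 2) k, ∀ x, u * σ x * u⁻¹ = σ' x) →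
      ∀ (B₁ B₂ : Γ → Matrix (Fin 2) (Fin 2) k),
      (¬ ∃ X : Matrix (Fin 2) (Fin 2) k, ∀ g, B₁ g = (σ g).val * X - X * (σ' g).val) →
      (¬ ∃ X : Matrix (Fin 2) (Fin 2) k, ∀ g, B₂ g = (σ g).val * X - X * (σ' g).val) →
      ∀ (N : Matrix (Fin 2 ⊕ Fin 2) (Fin 2 ⊕ Fin 2) k), N ≠ 0 →
      (∀ g, Matrix.fromBlocks (σ g).val (B₁ g) 0 (σ' g).val * N = N * Matrix.fromBlocks (σ g).val (B₂ g) 0 (σ' g).val) →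
      ∃ (c : kˣ) (X : Matrix (Fin 2) (Fin 2) k), ∀ g, B₂ g = (c : k) • B₁ g + ((σ g).val * X - X * (σ' g).val) := by
  intro k _ _ Γ _ σ σ' hσ hσ' hnc B₁ B₂ hB₁ hB₂ N hN hint
  exact class_unique_of_intertwiner σ σ' hσ hσ' hnc B₁ B₂ hB₁ hB₂ N hN hint

end Summit.Langlands.Langlands.Cruxes.ResiduallyYoshidaLifting.SectorKlingenSplit.Ribet

end
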